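import Mathlib
import Literature.Barriers.ValiantsHypothesis.AlgebraicNaturalProofs
import Literature.Barriers.ValiantsHypothesis.FullRankMultilinear
import Literature.Barriers.ValiantsHypothesis.FullRankMultilinearFamily
import Literature.Barriers.ValiantsHypothesis.FullRankMultilinearCoeff
import Literature.Barriers.ValiantsHypothesis.FullRankMultilinearProofs
import Literature.Barriers.ValiantsHypothesis.FullRankMultilinearCircuit
import HarnessLib

/-!
# Crux `BarrierLever.SuccinctHittingSetsForVP` (stmt-ValiantsHypothesis-14610), line `registered` —
stub `stub_fullRankSmallCircuit`: RAZ'S FULL-RANK MEASURE IS MAXIMAL ON SMALL CIRCUITS OVER `ℂ`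
(the min-partition-rank method at full threshold is not a natural proof against `VP` in the
regime `d = n`)

**What is proved (unconditional; evidence for the open crux in the direction it predicts for rank
methods; it does NOT close the item).** In FSV's framework over `ℂ` (tree regime `d = n`, simple
class `SmallCircuits ℂ N b = {f : deg f ≤ N, L(f) ≤ N^b}`):

* `stub_fullRankSmallCircuit` : for every `n ≥ 2` some `f ∈ SmallCircuits ℂ (2n) 4` is of FULL RANK
  in the sense of Raz (`Literature.Barriers.ValiantsHypothesis.IsFullRank`): for EVERY balanced
  partition `A : Fin (2n) ≃ Fin n ⊕ Fin n` of the variables into `Y ⊔ Z` the `2^n × 2^n` partial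
  derivative (coefficient) matrix of `f^A` has rank `2^n`.

Hence Raz's min-partition-rank measure `min_A rank M_{f^A}` attains its absolute maximum `2^n` on
a member of `SmallCircuits ℂ (2n) 4`: none of its thresholds "`rank M_{f^A} < 2^n` for some `A`" is
an equation for `VP` in the regime `d = n` — by an explicit small circuit, not by a conditional
barrier.

**Proof.** The witness is the Raz–Yehudayoff polynomial `f_{1,2n}` [RazYehudayoff2008, §4.1] at a
GENERIC COMPLEX SPECIALISATION of its auxiliary variables `ω_{i,ℓ,j} ↦ w_{i,ℓ,j} ∈ ℂ`, i.e. the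
member `ryFc ℂ (2n) (ω ↦ w) (n+1) (2n) 0` of the tree's family `RazYehudayoff.ryFc`
(`FullRankMultilinearFamily.lean`). (1) For the universal member `g` (coefficients `ω_{i,ℓ,j}` in
`R = ℂ[W]`, `RazYehudayoff.wPoly`) and every partition `A`, `det M_{g^A} ≠ 0` in `R`
(`det_cM_rename_ryFc_ne_zero`): by the effective Lemma 4.3 of the source (`RazYehudayoff.core_all`,
`ℂ` is an infinite field) some specialisation `ω ↦ c` makes `M` column-injective, hence invertible,
and the determinant specialises (`RazYehudayoff.det_cM_map_rename`) — verbatim the argument of the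
tree's `RazYehudayoff2008_thm42_holds`, with `ℂ` in place of `F(t)`. (2) The finite product over
all `A` of these determinants is a nonzero polynomial over the infinite domain `ℂ`, so it does not
vanish at some point `w` (`MvPolynomial.funext`); at `w` every `det M_{f^A}` is nonzero, so every
`M_{f^A}` is invertible of rank `2^n = |Finset (Fin n)|` (`exists_eval_det_ne_zero`,
`isFullRank_ryFc_eval`). (3) Size: the tabulated circuit `RazYehudayoff.ryCircuit` of
`FullRankMultilinearCircuit.lean` computes the member for ANY coefficients vanishing at `i ≥ 2n`
(`eval_ryCircuit`) with `n · 2n · (2n+1) ≤ (2n)^4` fan-in-two gates (`complexity_ryFc_le`).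
Degree: `deg f_{[i, i+len)} ≤ len` for even `len`, by
induction along the recursion `ryFc_succ` (`totalDegree_ryFc_le`), so `deg f ≤ 2n`.
Axioms: `propext`, `Classical.choice`, `Quot.sound`.

References: [RazYehudayoff2008] R. Raz, A. Yehudayoff, *Balancing syntactically multilinear
arithmetic circuits*, Comput. Complexity 17 (2008), §4.1, Thm. 4.2, Lemma 4.3, Thm. 4.4;
[ForbesShpilkaVolk2018] §1.2 (rank methods are algebraically natural), Cor. 5, Question 6.
-/

-- layout Summits/ValiantsHypothesis/ValiantsHypothesis forces the duplicated namespace component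
set_option linter.dupNamespace false

namespace Summit.ValiantsHypothesis.ValiantsHypothesis.Theorems.BarrierLever.SuccinctHittingSetsForVP

open Literature.Barriers.ValiantsHypothesis Literature.Computability.AlgebraicComplexity
open MvPolynomial Literature.Barriers.ValiantsHypothesis.RazYehudayoff

namespace FullRankSmallCircuit

/-! ### Degree of the members of the family -/

/-- `x_k` (or `0` out of range) has total degree at most `1`. [folklore] -/
theorem totalDegree_xv_le (S : Type*) [CommSemiring S] (N k : ℕ) :
    (xv S N k).totalDegree ≤ 1 := by
  unfold xv
  split_ifs with h
  · refine (totalDegree_monomial_le _ _).trans ?_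
    simp
  · simp

/-- **Degree of the Raz–Yehudayoff polynomials**: `deg f_{[i, i+len)} ≤ len` for every interval of
even length (any coefficients, any fuel): the head term `(1 + x_i x_{i+len-1}) f_{[i+1, i+len-1)}`
has degree `≤ 2 + (len - 2)` and a summand `c · f_{[i, i+a)} f_{[i+a, i+len)}` (`a` even) has degree
`≤ a + (len - a)`. [cite: RazYehudayoff2008, §4.1] -/
theorem totalDegree_ryFc_le (S : Type*) [CommSemiring S] (N : ℕ) (c : ℕ → ℕ → ℕ → S) :
    ∀ fuel len i : ℕ, Even len → (ryFc S N c fuel len i).totalDegree ≤ len := by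
  intro fuel
  induction fuel with
  | zero =>
    intro len i _
    simp [ryFc]
  | succ fuel ih =>
    intro len i hev
    by_cases hlen : len = 0
    · subst hlen
      simp
    · have h2 : 2 ≤ len := by
        obtain ⟨r, hr⟩ := hev
        omega
      rw [ryFc_succ c hlen]
      refine (totalDegree_add _ _).trans (max_le ?_ ?_)
      · have hhead : (1 + xv S N i * xv S N (i + len - 1)).totalDegree ≤ 2 :=
          (totalDegree_add _ _).trans (max_le (by rw [totalDegree_one]; exact Nat.zero_le _)
            ((totalDegree_mul _ _).trans
              (add_le_add (totalDegree_xv_le S N i) (totalDegree_xv_le S N (i + len - 1)))))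
        have htail := ih (len - 2) (i + 1) (by
          obtain ⟨r, hr⟩ := hev
          exact ⟨r - 1, by omega⟩)
        refine (totalDegree_mul _ _).trans ?_
        omega
      · refine totalDegree_finsetSum_le fun a ha => ?_
        simp only [Finset.mem_filter, Finset.mem_range] at ha
        obtain ⟨ha1, ha2, ha3⟩ := ha
        have heva : Even (len - a) := (Nat.even_sub (by omega)).2 (iff_of_true hev ha2)
        have h₁ := ih a i ha2
        have h₂ := ih (len - a) (i + a) heva
        have h₃ := (totalDegree_mul _ _).trans
          (add_le_add (totalDegree_C (c i (i + a - 1) (i + len - 1))).le h₁)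
        refine (totalDegree_mul _ _).trans ?_
        omega

/-! ### Size of the members of the family -/

/-- **Size**: for coefficients vanishing at `i ≥ 2n` the member `f_{[0, 2n)}` is computed by the
tabulated fan-in-two circuit `RazYehudayoff.ryCircuit` with `n · 2n · (2n+1)` gates, so its
fan-in-two complexity is at most that. [cite: RazYehudayoff2008, §4.1 and Thm. 4.4] -/
theorem complexity_ryFc_le (S : Type*) [CommSemiring S] (n : ℕ) (c : ℕ → ℕ → ℕ → S)
    (hc : ∀ i l j, 2 * n ≤ i → c i l j = 0) :
    complexity (ryFc S (2 * n) c (n + 1) (2 * n) 0) ≤ n * (2 * n) * (2 * n + 1) := by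
  have hev : (ryCircuit S n c).Computes (ryFc S (2 * n) c (n + 1) (2 * n) 0) := by
    show (ryCircuit S n c).eval = _
    rw [eval_ryCircuit S hc]
    show ryFc S (2 * n) c n (2 * n) 0 = ryFc S (2 * n) c (n + 1) (2 * n) 0
    exact ryFc_stable c (by omega) (by omega) 0
  rw [← size_ryCircuit S n c]
  exact Nat.sInf_le ⟨ryCircuit S n c, isFanInTwo_ryCircuit S n c, hev, rfl⟩

/-- `n · 2n · (2n+1) ≤ (2n)^4`. [folklore] -/
theorem size_le_pow_four (n : ℕ) : n * (2 * n) * (2 * n + 1) ≤ (2 * n) ^ 4 := by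
  have h1 : n * (2 * n) * (2 * n + 1) = 4 * n ^ 3 + 2 * n ^ 2 := by ring
  have h2 : (2 * n) ^ 4 = 16 * n ^ 4 := by ring
  rw [h1, h2]
  rcases Nat.eq_zero_or_pos n with h | h
  · subst h
    simp
  · have h3 : n ^ 2 ≤ n ^ 3 := Nat.pow_le_pow_right h (by norm_num)
    have h4 : n ^ 3 ≤ n ^ 4 := Nat.pow_le_pow_right h (by norm_num)
    omega

/-- **Membership in the simple class**: for coefficients vanishing at `i ≥ 2n` the member
`f_{[0, 2n)}` over a field `F` lies in `SmallCircuits F (2n) 4` (degree `≤ 2n`, size `≤ (2n)^4`).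
[cite: ForbesShpilkaVolk2018, Cor. 5] -/
theorem ryFc_mem_smallCircuits (F : Type*) [Field F] (n : ℕ) (c : ℕ → ℕ → ℕ → F)
    (hc : ∀ i l j, 2 * n ≤ i → c i l j = 0) :
    ryFc F (2 * n) c (n + 1) (2 * n) 0 ∈ SmallCircuits F (2 * n) 4 := by
  show (ryFc F (2 * n) c (n + 1) (2 * n) 0).totalDegree ≤ 2 * n ∧
    complexity (ryFc F (2 * n) c (n + 1) (2 * n) 0) ≤ (2 * n) ^ 4
  exact ⟨totalDegree_ryFc_le F (2 * n) c (n + 1) (2 * n) 0 (even_two_mul n),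
    (complexity_ryFc_le F n c hc).trans (size_le_pow_four n)⟩

/-! ### Full rank at a generic specialisation -/

/-- Out of range the universal coefficients `ω_{i,ℓ,j}` vanish, hence so do their values.
[folklore] -/
theorem eval_wPoly_eq_zero (K : Type*) [Field K] {N : ℕ} (w : RYAux N → K) {i : ℕ} (hi : N ≤ i)
    (l j : ℕ) : eval w (wPoly K N i l j) = 0 := by
  unfold wPoly
  rw [dif_neg (by omega), map_zero]

/-- **`det M_{g^A} ≠ 0` in `K[W]` for the universal member** `g = f_{1,2n}` (coefficients the
variables `ω_{i,ℓ,j} ∈ K[W]`) and every partition `A`, over an infinite field `K`: the effective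
Lemma 4.3 (`RazYehudayoff.core_all`) gives a specialisation `ω ↦ c ∈ K` at which the coefficient
matrix is column-injective, hence invertible, and the determinant specialises.
[cite: RazYehudayoff2008, Thm. 4.2 and Lemma 4.3] -/
theorem det_cM_rename_ryFc_ne_zero (K : Type*) [Field K] [Infinite K] (n : ℕ)
    (A : Fin (2 * n) ≃ Fin n ⊕ Fin n) :
    (cM (rename A (ryFc (MvPolynomial (RYAux (2 * n)) K) (2 * n) (wPoly K (2 * n))
      (n + 1) (2 * n) 0))).det ≠ 0 := by
  -- adapted from `RazYehudayoff2008_thm42_holds` (FullRankMultilinearProofs.lean)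
  classical
  intro h0
  obtain ⟨c, hc⟩ := core_all K (2 * n) (colOf A)
  let φ : MvPolynomial (RYAux (2 * n)) K →+* K := eval fun w => c w.1 w.2.1 w.2.2
  have h3 : (cM (rename A (MvPolynomial.map φ (ryFc (MvPolynomial (RYAux (2 * n)) K) (2 * n)
      (wPoly K (2 * n)) (n + 1) (2 * n) 0)))).det = 0 := by
    rw [det_cM_map_rename, h0, map_zero]
  have h4 : MvPolynomial.map φ (ryFc (MvPolynomial (RYAux (2 * n)) K) (2 * n) (wPoly K (2 * n))
      (n + 1) (2 * n) 0) = ryFc K (2 * n) c (n + 1) (2 * n) 0 := by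
    rw [map_ryFc]
    apply ryFc_congr
    intro i' l j' _ _ _ hj'
    have hi' : i' < 2 * n := by omega
    have hl : l < 2 * n := by omega
    have hj'' : j' < 2 * n := by omega
    simp only [wPoly, dif_pos (show i' < 2 * n ∧ l < 2 * n ∧ j' < 2 * n from ⟨hi', hl, hj''⟩)]
    simp [φ]
  rw [h4] at h3
  have h5 := hc (2 * n) 0 (n + 1) (even_two_mul n) (by omega) (Dd_colOf A) (by omega)
  rw [YI_colOf, ZI_colOf] at h5
  have h6 := Matrix.mulVec_injective_iff_isUnit.1 (injective_mulVec_cM A _ h5)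
  rw [Matrix.isUnit_iff_isUnit_det, isUnit_iff_ne_zero] at h6
  exact h6 h3

/-- **A generic point**: over an infinite field `K` some specialisation `w` of the auxiliary
variables makes `det M_{g^A}` nonzero for ALL partitions `A` simultaneously (the finitely many
determinants are nonzero polynomials, so their product has a non-root). [folklore] -/
theorem exists_eval_det_ne_zero (K : Type*) [Field K] [Infinite K] (n : ℕ) :
    ∃ w : RYAux (2 * n) → K, ∀ A : Fin (2 * n) ≃ Fin n ⊕ Fin n,
      eval w (cM (rename A (ryFc (MvPolynomial (RYAux (2 * n)) K) (2 * n) (wPoly K (2 * n))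
        (n + 1) (2 * n) 0))).det ≠ 0 := by
  classical
  set g := ryFc (MvPolynomial (RYAux (2 * n)) K) (2 * n) (wPoly K (2 * n)) (n + 1) (2 * n) 0
    with hg
  have hprod : (∏ A : Fin (2 * n) ≃ Fin n ⊕ Fin n, (cM (rename A g)).det) ≠ 0 :=
    Finset.prod_ne_zero_iff.2 fun A _ => det_cM_rename_ryFc_ne_zero K n A
  obtain ⟨w, hw⟩ : ∃ w : RYAux (2 * n) → K,
      eval w (∏ A : Fin (2 * n) ≃ Fin n ⊕ Fin n, (cM (rename A g)).det) ≠ 0 := by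
    by_contra hcon
    push Not at hcon
    exact hprod (MvPolynomial.funext fun v => by rw [map_zero]; exact hcon v)
  refine ⟨w, fun A h0 => hw ?_⟩
  rw [map_prod]
  exact Finset.prod_eq_zero (Finset.mem_univ A) h0

/-- **Full rank at a generic point**: if `w` is a common non-root of the determinants, the
specialised Raz–Yehudayoff polynomial `f = f_{1,2n}(x, w)` over `K` is of full rank — for every
partition `A`, `det M_{f^A} = (det M_{g^A})(w) ≠ 0`, so `M_{f^A}` is invertible of rank
`2^n`. [cite: RazYehudayoff2008, Thm. 4.2] -/
theorem isFullRank_ryFc_eval (K : Type*) [Field K] (n : ℕ) (w : RYAux (2 * n) → K)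
    (hw : ∀ A : Fin (2 * n) ≃ Fin n ⊕ Fin n,
      eval w (cM (rename A (ryFc (MvPolynomial (RYAux (2 * n)) K) (2 * n) (wPoly K (2 * n))
        (n + 1) (2 * n) 0))).det ≠ 0) :
    IsFullRank n
      (ryFc K (2 * n) (fun i l j => eval w (wPoly K (2 * n) i l j)) (n + 1) (2 * n) 0) := by
  classical
  intro A
  have hmap : MvPolynomial.map (eval w) (ryFc (MvPolynomial (RYAux (2 * n)) K) (2 * n)
      (wPoly K (2 * n)) (n + 1) (2 * n) 0) =
        ryFc K (2 * n) (fun i l j => eval w (wPoly K (2 * n) i l j)) (n + 1) (2 * n) 0 :=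
    map_ryFc _ _ _ _ _
  have hdet : (pdMatrix (rename A (ryFc K (2 * n) (fun i l j => eval w (wPoly K (2 * n) i l j))
      (n + 1) (2 * n) 0))).det ≠ 0 := by
    rw [pdMatrix_eq_cM, ← hmap, det_cM_map_rename]
    exact hw A
  have hU : IsUnit (pdMatrix (rename A (ryFc K (2 * n)
      (fun i l j => eval w (wPoly K (2 * n) i l j)) (n + 1) (2 * n) 0))) :=
    (Matrix.isUnit_iff_isUnit_det _).2 (isUnit_iff_ne_zero.2 hdet)
  rw [Matrix.rank_of_isUnit _ hU, Fintype.card_finset, Fintype.card_fin]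

end FullRankSmallCircuit

/-- **Registered stub `stub_fullRankSmallCircuit`** (crux stmt-ValiantsHypothesis-14610, line
`registered`, wave 6): for every `n ≥ 2` some `f ∈ SmallCircuits ℂ (2n) 4` is of full rank for
EVERY balanced partition — the Raz–Yehudayoff polynomial at a generic complex specialisation of its
auxiliary variables. (The hypothesis `2 ≤ n` is part of the registered signature; the proof does
not use it.) [cite: RazYehudayoff2008, Thm. 4.2 and Thm. 4.4] -/
theorem stub_fullRankSmallCircuit :
    ∀ n : ℕ, 2 ≤ n → ∃ f ∈ SmallCircuits ℂ (2 * n) 4,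
      Literature.Barriers.ValiantsHypothesis.IsFullRank n f := by
  intro n _hn
  obtain ⟨w, hw⟩ := FullRankSmallCircuit.exists_eval_det_ne_zero ℂ n
  exact ⟨_, FullRankSmallCircuit.ryFc_mem_smallCircuits ℂ n _
    (fun i l j hi => FullRankSmallCircuit.eval_wPoly_eq_zero ℂ w hi l j),
    FullRankSmallCircuit.isFullRank_ryFc_eval ℂ n w hw⟩

end Summit.ValiantsHypothesis.ValiantsHypothesis.Theorems.BarrierLever.SuccinctHittingSetsForVP
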